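import Mathlib

/-!
# WeilTangent — the rank count behind PROPOSITION W4 (solo-blind s44)

Abstract linear-algebra core of the genus-4 hyperelliptic tangent obstruction used in
THEOREM TF₈ (HOME `work/s44/hain-floor.md` §5).  There `μ : Sym² H⁰(K_C) → H⁰(2K_C)` is the
multiplication map of a hyperelliptic genus-4 curve, `A = Sym² V₊`, `B = Sym² V₋` for a splitting
`H⁰(K_C) = V₊ ⊕ V₋` into 2-planes, and the tangency condition (TAN) says `ker μ ≤ A ⊔ B`.
The purely dimensional consequence proved here is: if the kernel of a linear map is trapped in
`A ⊔ B`, then `dim μ(A ⊔ B) + dim ker μ ≤ dim A + dim B`; with `dim A = dim B = dim ker μ =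
dim μ(A) = 3` this forces `μ(B) ≤ μ(A)` (indeed `μ(A) = μ(B)`), which the PENCIL LEMMA then
contradicts.  Only the linear algebra is formalised; the geometry stays on paper.
-/

namespace Summit.HodgeConjecture.HodgeConjecture.Theorems.WeilTangent

open Module

variable {K : Type*} [Field K] {U W : Type*} [AddCommGroup U] [Module K U]
  [AddCommGroup W] [Module K W] [FiniteDimensional K U]

omit [FiniteDimensional K U] in
/-- The range of `μ` restricted to a submodule `S` is `μ(S)`. -/
theorem range_domRestrict_eq_map (μ : U →ₗ[K] W) (S : Submodule K U) :
    LinearMap.range (μ.domRestrict S) = Submodule.map μ S := by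
  ext w
  constructor
  · rintro ⟨⟨u, hu⟩, rfl⟩
    exact ⟨u, hu, rfl⟩
  · rintro ⟨u, hu, rfl⟩
    exact ⟨⟨u, hu⟩, rfl⟩

omit [FiniteDimensional K U] in
/-- If `ker μ ≤ S`, the kernel of `μ|_S` has the same dimension as `ker μ`. -/
theorem finrank_ker_domRestrict_of_le (μ : U →ₗ[K] W) (S : Submodule K U)
    (hker : LinearMap.ker μ ≤ S) :
    finrank K (LinearMap.ker (μ.domRestrict S)) = finrank K (LinearMap.ker μ) := by
  have hcomap : LinearMap.ker (μ.domRestrict S) = Submodule.comap S.subtype (LinearMap.ker μ) := by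
    ext ⟨u, hu⟩
    simp [LinearMap.mem_ker]
  rw [hcomap]
  exact LinearEquiv.finrank_eq (Submodule.comapSubtypeEquivOfLe hker)

/-- TRAPPED-KERNEL INEQUALITY. If `ker μ ≤ A ⊔ B` then
`dim μ(A ⊔ B) + dim ker μ ≤ dim A + dim B`. -/
theorem finrank_map_sup_add_finrank_ker_le (μ : U →ₗ[K] W) (A B : Submodule K U)
    (hker : LinearMap.ker μ ≤ A ⊔ B) :
    finrank K (Submodule.map μ (A ⊔ B)) + finrank K (LinearMap.ker μ)
      ≤ finrank K A + finrank K B := by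
  have h1 := LinearMap.finrank_range_add_finrank_ker (μ.domRestrict (A ⊔ B))
  rw [range_domRestrict_eq_map, finrank_ker_domRestrict_of_le μ (A ⊔ B) hker] at h1
  have h2 := Submodule.finrank_sup_add_finrank_inf_eq A B
  omega

/-- RANK COUNT of PROPOSITION W4 (general form). If `ker μ ≤ A ⊔ B` and
`dim A + dim B ≤ dim μ(A) + dim ker μ`, then `μ(B) ≤ μ(A)` (indeed `μ(A ⊔ B) = μ(A)`). -/
theorem map_le_map_of_trapped_kernel (μ : U →ₗ[K] W) (A B : Submodule K U)
    (hker : LinearMap.ker μ ≤ A ⊔ B)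
    (hcount : finrank K A + finrank K B ≤ finrank K (Submodule.map μ A) + finrank K (LinearMap.ker μ)) :
    Submodule.map μ B ≤ Submodule.map μ A := by
  have hle : Submodule.map μ A ≤ Submodule.map μ (A ⊔ B) := Submodule.map_mono le_sup_left
  have hineq := finrank_map_sup_add_finrank_ker_le μ A B hker
  have hfin : finrank K (Submodule.map μ (A ⊔ B)) ≤ finrank K (Submodule.map μ A) := by omega
  have heq : Submodule.map μ A = Submodule.map μ (A ⊔ B) :=
    Submodule.eq_of_le_of_finrank_le hle hfin
  calc Submodule.map μ B ≤ Submodule.map μ (A ⊔ B) := Submodule.map_mono le_sup_right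
    _ = Submodule.map μ A := heq.symm

/-- The instance used in PROPOSITION W4: `dim A = dim B = dim ker μ = dim μ(A) = dim μ(B) = 3`
and `ker μ ≤ A ⊔ B` force `μ(A) = μ(B)` (in the application: `V₊·V₊ = V₋·V₋`). -/
theorem map_eq_map_of_trapped_kernel_three (μ : U →ₗ[K] W) (A B : Submodule K U)
    (hker : LinearMap.ker μ ≤ A ⊔ B)
    (hA : finrank K A = 3) (hB : finrank K B = 3) (hk : finrank K (LinearMap.ker μ) = 3)
    (hμA : finrank K (Submodule.map μ A) = 3) (hμB : finrank K (Submodule.map μ B) = 3) :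
    Submodule.map μ A = Submodule.map μ B := by
  apply le_antisymm
  · have hker' : LinearMap.ker μ ≤ B ⊔ A := by rwa [sup_comm]
    exact map_le_map_of_trapped_kernel μ B A hker' (by omega)
  · exact map_le_map_of_trapped_kernel μ A B hker (by omega)

/-- Numerical bookkeeping of the application (genus 4, hyperelliptic): `dim Sym² H⁰(K) = 10`,
`dim H⁰(2K) = 7 = 2g - 1` (so `dim ker μ = 3 = dim I₂`), `dim Sym² V± = 3`, mixed part
`dim V₊ ⊗ V₋ = 4 = dim W′`, and `dim T j(𝓗₄) = 2g - 1 = 7`. -/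
theorem genus_four_bookkeeping :
    Nat.choose (4 + 1) 2 = 10 ∧ 2 * 4 - 1 = 7 ∧ 10 - 7 = 3 ∧ Nat.choose (2 + 1) 2 = 3 ∧
    2 * 2 = 4 ∧ 3 + 4 + 3 = 10 := by
  refine ⟨by decide, by norm_num, by norm_num, by decide, by norm_num, by norm_num⟩

end Summit.HodgeConjecture.HodgeConjecture.Theorems.WeilTangent
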